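import Mathlib
import HarnessLib
import Summits.HubbardSuperconductivity.HubbardSuperconductivity.Theorems.KLProgrammeH10TwoPointLimitPerturbedFermiRadius

/-!
# Route `KLProgramme` — crux K1 `H10TwoPointLimit` (stmt-HubbardSuperconductivity-19938):
# the perturbed Fermi curve `{ε₀ + δ = μ}` — angular REGULARITY of the radial graph and BGM (2.40) at first order

Continues `KLProgrammeH10TwoPointLimitPerturbedFermiRadius.lean` (order zero: existence, level shift, closeness `κ₀/Dt_min`,
uniqueness). Here the implicit-function step of Benfatto–Giuliani–Mastropietro 2006, Lemma 2.1 proper: for a `Cⁿ` perturbation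
`δ` (`n ≥ 1`) with `|δ| ≤ κ₀` and `‖Dδ‖ ≤ κ₁ < Dt_min` on the closed square, and ANY selection `u : ℝ → ℝ` of Fermi points of
`ε₀ + δ` at level `μ` (`IsBandFermiRadius (μ - δ(u θ·dir θ)) θ (u θ)` for all `θ`; unique by `shifted_unique`, so `u` IS the polar
radius `u_E` of the interacting curve):

* §1 calculus of the level function `G(θ, t) = ε₀(t·dir θ) + δ(t·dir θ)`: `dir` is smooth with `(d/dθ) dir θ = dir(θ + π/2)`;
  the partials `∂_t G = ∂_t F + Dδ(t·dir θ)[dir θ]`, `∂_θ G = ∂_θ F + Dδ(t·dir θ)[t·dir(θ + π/2)]`, the Fréchet derivative of `G`,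
  and the size bounds `|Dδ[dir θ]| ≤ κ₁`, `|Dδ[t·dir(θ+π/2)]| ≤ κ₁|t|` (sup norm, `‖dir‖_∞ ≤ 1`);
* §2 **`u` is `Cⁿ`** (`contDiffAt_of_isRoot`, `contDiff_of_isRoot`): `∂_t G ≥ Dt_min - κ₁ > 0` at a Fermi point
  (`Dtmin_sub_le_pertDt`), Mathlib's `ContDiffAt.implicitFunction`, and identification of `u` with the implicit function near each
  angle by ray-wise uniqueness (`shifted_unique`) — no separate continuity argument is needed;
* §3 **the derivative** `u' = -∂_θG/∂_tG` at `(θ, u θ)` (`hasDerivAt_of_isRoot`, differentiating `G(θ, u θ) = μ`), the bound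
  `|u'| ≤ (4 + κ₁) u/(Dt_min - κ₁)`, and **BGM (2.40) at first order**: at each angle the perturbed radius EQUALS the free radius of the
  shifted level `ν(θ) = μ - δ(u θ·dir θ) ∈ [μ - κ₀, μ + κ₀]` and its slope is within
  `κ₁ (u θ + |u_ν'(θ)|)/(Dt_min - κ₁)` of the free slope `u_ν'(θ) = bandFermiRadiusDeriv ν θ` there
  (`abs_deriv_sub_bandFermiRadiusDeriv_le`) — so the level-uniform speed bounds of `BandBounds` transfer with an `O(κ₁)` loss.

Everything is PROVED; no definitions, no named facts. Second-order closeness (BGM (2.41), the curvature constants of the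
perturbed curve) is the next file. References: BGM 2006 §2.4 Lemma 2.1 (2.40)–(2.41) [cite: BenfattoGiulianiMastropietro2006];
cell gate-hubbard-kl GAP-LEDGER G-002 («closer (ii)»), HOME/prover-p4/INVERSION-NOTE.md §2 Lemma I (ii), §4 (b2).
-/

noncomputable section

namespace Summit.HubbardSuperconductivity.HubbardSuperconductivity.Theorems.PerturbedFermiCurve

set_option linter.dupNamespace false -- summit = problem name (single-conjunct summit), D-0017

open Real Set Filter
open scoped Topology ContDiff
open Literature.MathematicalPhysics.QuantumLattice Literature.MathematicalPhysics.QuantumLattice.BandSectorCounting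

/-! ## §1 Calculus of the perturbed level function along rays -/

/-- The direction map `θ ↦ (cos θ, sin θ)` is smooth. [folklore] -/
theorem contDiff_dir {n : WithTop ℕ∞} : ContDiff ℝ n dir := by
  refine contDiff_pi.2 fun i => ?_
  fin_cases i
  · simpa [dir] using Real.contDiff_cos
  · simpa [dir] using Real.contDiff_sin

/-- `(d/dθ) dir θ = dir (θ + π/2) = (-sin θ, cos θ)`. [folklore] -/
theorem hasDerivAt_dir (θ : ℝ) : HasDerivAt dir (dir (θ + π / 2)) θ := by
  refine hasDerivAt_pi.2 fun i => ?_
  fin_cases i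
  · simpa [dir, Real.cos_add_pi_div_two] using Real.hasDerivAt_cos θ
  · simpa [dir, Real.sin_add_pi_div_two] using Real.hasDerivAt_sin θ

/-- `(d/dθ) (t·dir θ) = t·dir (θ + π/2)`. [folklore] -/
theorem hasDerivAt_smul_dir_angle (t θ : ℝ) : HasDerivAt (fun ϑ : ℝ => t • dir ϑ) (t • dir (θ + π / 2)) θ :=
  (hasDerivAt_dir θ).const_smul t

/-- The map `(θ, t) ↦ t·dir θ` is smooth. [folklore] -/
theorem contDiff_smul_dir {n : WithTop ℕ∞} : ContDiff ℝ n fun p : ℝ × ℝ => p.2 • dir p.1 :=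
  contDiff_snd.smul (contDiff_dir.comp contDiff_fst)

/-- **The perturbed level function `G(θ, t) = ε₀(t·dir θ) + δ(t·dir θ)` is `Cⁿ` when `δ` is.** [folklore] -/
theorem contDiff_pertLevel {δ : (Fin 2 → ℝ) → ℝ} {n : WithTop ℕ∞} (hδ : ContDiff ℝ n δ) :
    ContDiff ℝ n fun p : ℝ × ℝ => rayDispersion p + δ (p.2 • dir p.1) :=
  contDiff_rayDispersion.add (hδ.comp contDiff_smul_dir)

/-- **The radial partial** `∂_t G(θ, t) = ∂_t F(θ, t) + Dδ(t·dir θ)[dir θ]`. [folklore] -/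
theorem hasDerivAt_pertLevel_radius {δ : (Fin 2 → ℝ) → ℝ} {θ t : ℝ} (hd : DifferentiableAt ℝ δ (t • dir θ)) :
    HasDerivAt (fun s : ℝ => rayDispersion (θ, s) + δ (s • dir θ))
      (rayDispersionDt θ t + fderiv ℝ δ (t • dir θ) (dir θ)) t :=
  (hasDerivAt_rayDispersion_radius θ t).add (hd.hasFDerivAt.comp_hasDerivAt t (hasDerivAt_smul_dir θ t))

/-- **The angular partial** `∂_θ G(θ, t) = ∂_θ F(θ, t) + Dδ(t·dir θ)[t·dir(θ + π/2)]`. [folklore] -/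
theorem hasDerivAt_pertLevel_angle {δ : (Fin 2 → ℝ) → ℝ} {θ t : ℝ} (hd : DifferentiableAt ℝ δ (t • dir θ)) :
    HasDerivAt (fun ϑ : ℝ => rayDispersion (ϑ, t) + δ (t • dir ϑ))
      (rayDispersionDθ θ t + fderiv ℝ δ (t • dir θ) (t • dir (θ + π / 2))) θ :=
  (hasDerivAt_rayDispersion_angle θ t).add (hd.hasFDerivAt.comp_hasDerivAt θ (hasDerivAt_smul_dir_angle t θ))

/-- **The Fréchet derivative of `G`** in terms of the two partials: `DG(θ, t)(a, c) = a ∂_θG + c ∂_tG`. [folklore] -/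
theorem fderiv_pertLevel_apply {δ : (Fin 2 → ℝ) → ℝ} {θ t : ℝ}
    (hG : DifferentiableAt ℝ (fun p : ℝ × ℝ => rayDispersion p + δ (p.2 • dir p.1)) (θ, t))
    (hd : DifferentiableAt ℝ δ (t • dir θ)) (a c : ℝ) :
    fderiv ℝ (fun p : ℝ × ℝ => rayDispersion p + δ (p.2 • dir p.1)) (θ, t) (a, c) =
      a * (rayDispersionDθ θ t + fderiv ℝ δ (t • dir θ) (t • dir (θ + π / 2))) +
        c * (rayDispersionDt θ t + fderiv ℝ δ (t • dir θ) (dir θ)) := by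
  set G : ℝ × ℝ → ℝ := fun p => rayDispersion p + δ (p.2 • dir p.1) with hGdef
  have hF : HasFDerivAt G (fderiv ℝ G (θ, t)) (θ, t) := hG.hasFDerivAt
  have h1 : fderiv ℝ G (θ, t) (1, 0) = rayDispersionDθ θ t + fderiv ℝ δ (t • dir θ) (t • dir (θ + π / 2)) := by
    have hg : HasDerivAt (fun ϑ : ℝ => ((ϑ, t) : ℝ × ℝ)) ((1 : ℝ), (0 : ℝ)) θ :=
      (hasDerivAt_id θ).prodMk (hasDerivAt_const θ t)
    have hc : HasDerivAt (G ∘ fun ϑ : ℝ => ((ϑ, t) : ℝ × ℝ)) (fderiv ℝ G (θ, t) (1, 0)) θ :=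
      HasFDerivAt.comp_hasDerivAt (l := G) (f := fun ϑ : ℝ => ((ϑ, t) : ℝ × ℝ)) θ hF hg
    exact hc.unique (hasDerivAt_pertLevel_angle hd)
  have h2 : fderiv ℝ G (θ, t) (0, 1) = rayDispersionDt θ t + fderiv ℝ δ (t • dir θ) (dir θ) := by
    have hg : HasDerivAt (fun s : ℝ => ((θ, s) : ℝ × ℝ)) ((0 : ℝ), (1 : ℝ)) t :=
      (hasDerivAt_const t θ).prodMk (hasDerivAt_id t)
    have hc : HasDerivAt (G ∘ fun s : ℝ => ((θ, s) : ℝ × ℝ)) (fderiv ℝ G (θ, t) (0, 1)) t :=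
      HasFDerivAt.comp_hasDerivAt (l := G) (f := fun s : ℝ => ((θ, s) : ℝ × ℝ)) t hF hg
    exact hc.unique (hasDerivAt_pertLevel_radius hd)
  have hab : ((a, c) : ℝ × ℝ) = a • ((1 : ℝ), (0 : ℝ)) + c • ((0 : ℝ), (1 : ℝ)) := by ext <;> simp
  rw [hab, map_add, map_smul, map_smul, h1, h2, smul_eq_mul, smul_eq_mul]

/-- A sup-norm gradient bound bounds the radial directional derivative: `|Dδ(k)[dir θ]| ≤ κ₁` (`‖dir θ‖_∞ ≤ 1`). [folklore] -/
theorem abs_fderiv_dir_le {δ : (Fin 2 → ℝ) → ℝ} {k : Fin 2 → ℝ} {κ₁ : ℝ} (h : ‖fderiv ℝ δ k‖ ≤ κ₁) (θ : ℝ) :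
    |fderiv ℝ δ k (dir θ)| ≤ κ₁ := by
  rw [← Real.norm_eq_abs]
  refine ((fderiv ℝ δ k).le_opNorm _).trans ?_
  calc ‖fderiv ℝ δ k‖ * ‖dir θ‖ ≤ ‖fderiv ℝ δ k‖ * 1 := mul_le_mul_of_nonneg_left (norm_dir_le_one θ) (norm_nonneg _)
    _ ≤ κ₁ := by rw [mul_one]; exact h

/-- The angular directional derivative: `|Dδ(k)[t·dir θ']| ≤ κ₁ |t|`. [folklore] -/
theorem abs_fderiv_smul_dir_le {δ : (Fin 2 → ℝ) → ℝ} {k : Fin 2 → ℝ} {κ₁ : ℝ} (h : ‖fderiv ℝ δ k‖ ≤ κ₁) (t θ' : ℝ) :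
    |fderiv ℝ δ k (t • dir θ')| ≤ κ₁ * |t| := by
  rw [map_smul, smul_eq_mul, abs_mul, mul_comm]
  exact mul_le_mul_of_nonneg_right (abs_fderiv_dir_le h θ') (abs_nonneg t)

/-- `|∂_θ F(θ, t)| ≤ 4|t|`. [folklore] -/
theorem abs_rayDispersionDθ_le (θ t : ℝ) : |rayDispersionDθ θ t| ≤ 4 * |t| := by
  unfold rayDispersionDθ
  have h1 : |Real.cos θ * Real.sin (t * Real.sin θ) - Real.sin θ * Real.sin (t * Real.cos θ)| ≤ 2 := by
    refine (abs_sub _ _).trans ?_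
    rw [abs_mul, abs_mul]
    have := Real.abs_cos_le_one θ; have := Real.abs_sin_le_one θ
    have := Real.abs_sin_le_one (t * Real.sin θ); have := Real.abs_sin_le_one (t * Real.cos θ)
    nlinarith [abs_nonneg (Real.cos θ), abs_nonneg (Real.sin θ), abs_nonneg (Real.sin (t * Real.sin θ)),
      abs_nonneg (Real.sin (t * Real.cos θ))]
  rw [abs_mul, abs_mul, abs_two]
  nlinarith [abs_nonneg t, abs_nonneg (Real.cos θ * Real.sin (t * Real.sin θ) - Real.sin θ * Real.sin (t * Real.cos θ))]

/-! ## §2 Any selection of perturbed Fermi points is `Cⁿ` in the angle -/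

section Regularity

variable {a b : ℝ} (B : BandBounds a b) {δ : (Fin 2 → ℝ) → ℝ} {n : WithTop ℕ∞} (hδs : ContDiff ℝ n δ) (hn : n ≠ 0)
  {κ₀ κ₁ μ : ℝ} (hδ : ∀ k : Fin 2 → ℝ, (∀ i, |k i| ≤ π) → |δ k| ≤ κ₀) (hlo : a ≤ μ - κ₀) (hhi : μ + κ₀ ≤ b)
  (hκ : ∀ k : Fin 2 → ℝ, (∀ i, |k i| ≤ π) → ‖fderiv ℝ δ k‖ ≤ κ₁) (hκ₁ : κ₁ < B.Dtmin)
  {u : ℝ → ℝ} (hu : ∀ θ, IsBandFermiRadius (μ - δ (u θ • dir θ)) θ (u θ))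
include B hδs hn hδ hlo hhi hκ hκ₁ hu

omit hδs hn hκ₁ in
/-- **Radial transversality of the PERTURBED level function at a Fermi point**: `∂_t G(θ, u θ) ≥ Dt_min - κ₁ (> 0)`.
[cite: BenfattoGiulianiMastropietro2006, §2.4 Lemma 2.1] -/
theorem Dtmin_sub_le_pertDt (θ : ℝ) :
    B.Dtmin - κ₁ ≤ rayDispersionDt θ (u θ) + fderiv ℝ δ (u θ • dir θ) (dir θ) := by
  have h1 : B.Dtmin ≤ rayDispersionDt θ (u θ) := Dtmin_le_rayDispersionDt_of_shifted B hδ hlo hhi (hu θ)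
  have h2 := (abs_le.1 (abs_fderiv_dir_le (hκ _ (abs_apply_le_pi_of_isBandFermiRadius (hu θ))) θ)).1
  linarith

omit hδs hn in
/-- `∂_t G(θ, u θ) > 0`. [folklore] -/
theorem pertDt_pos (θ : ℝ) : 0 < rayDispersionDt θ (u θ) + fderiv ℝ δ (u θ • dir θ) (dir θ) := by
  have h1 : B.Dtmin ≤ rayDispersionDt θ (u θ) := Dtmin_le_rayDispersionDt_of_shifted B hδ hlo hhi (hu θ)
  have h2 := (abs_le.1 (abs_fderiv_dir_le (hκ _ (abs_apply_le_pi_of_isBandFermiRadius (hu θ))) θ)).1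
  linarith

/-- **Any selection of perturbed Fermi points is `Cⁿ`** (BGM 2006 Lemma 2.1, the implicit-function step): if `δ ∈ Cⁿ`, `n ≥ 1`,
`|δ| ≤ κ₀` and `‖Dδ‖ ≤ κ₁ < Dt_min` on the closed square, `[μ - κ₀, μ + κ₀] ⊂ [a, b]`, then every `u` with
`IsBandFermiRadius (μ - δ(u θ·dir θ)) θ (u θ)` for all `θ` is `Cⁿ` at every angle. [cite: BenfattoGiulianiMastropietro2006, §2.4 Lemma 2.1 (2.40)] -/
theorem contDiffAt_of_isRoot (θ₀ : ℝ) : ContDiffAt ℝ n u θ₀ := by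
  set G : ℝ × ℝ → ℝ := fun p => rayDispersion p + δ (p.2 • dir p.1) with hGdef
  have hdiffδ : ∀ k, DifferentiableAt ℝ δ k := fun k => (hδs.differentiable hn) k
  have hroot := hu θ₀
  have cdf : ContDiffAt ℝ n G (θ₀, u θ₀) := (contDiff_pertLevel hδs).contDiffAt
  -- the `t`-partial is invertible
  have hGt := pertDt_pos B hδ hlo hhi hκ hκ₁ hu θ₀
  have hinr : ∀ c : ℝ, (fderiv ℝ G (θ₀, u θ₀) ∘L ContinuousLinearMap.inr ℝ ℝ ℝ) c =
      c * (rayDispersionDt θ₀ (u θ₀) + fderiv ℝ δ (u θ₀ • dir θ₀) (dir θ₀)) := by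
    intro c
    rw [ContinuousLinearMap.comp_apply, ContinuousLinearMap.inr_apply,
      fderiv_pertLevel_apply (cdf.differentiableAt hn) (hdiffδ _)]
    ring
  have if₂ : (fderiv ℝ G (θ₀, u θ₀) ∘L ContinuousLinearMap.inr ℝ ℝ ℝ).IsInvertible := by
    refine ⟨ContinuousLinearEquiv.unitsEquivAut ℝ (Units.mk0 _ hGt.ne'), ContinuousLinearMap.ext_ring ?_⟩
    rw [ContinuousLinearEquiv.coe_coe, ContinuousLinearEquiv.unitsEquivAut_apply, Units.val_mk0, hinr, one_mul]
  -- the implicit function at `(θ₀, u θ₀)`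
  have hψ : ContDiffAt ℝ n (cdf.implicitFunction hn if₂) θ₀ := cdf.contDiffAt_implicitFunction hn if₂
  have hψ0 : cdf.implicitFunction hn if₂ θ₀ = u θ₀ := cdf.implicitFunction_apply_self hn if₂
  have hψeq : ∀ᶠ θ in 𝓝 θ₀, G (θ, cdf.implicitFunction hn if₂ θ) = G (θ₀, u θ₀) :=
    cdf.eventually_apply_implicitFunction hn if₂
  have hG0 : G (θ₀, u θ₀) = μ := by
    show rayDispersion (θ₀, u θ₀) + δ (u θ₀ • dir θ₀) = μ
    linarith [hroot.2]
  -- its values stay inside the open segment near `θ₀`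
  have hI := mem_Ioo_of_shifted B hδ hlo hhi hroot
  have hψc : ContinuousAt (cdf.implicitFunction hn if₂) θ₀ := hψ.continuousAt
  have hev1 : ∀ᶠ θ in 𝓝 θ₀, 0 < cdf.implicitFunction hn if₂ θ :=
    hψc.eventually (lt_mem_nhds (by rw [hψ0]; exact hI.1))
  have hexitc : Continuous fun θ : ℝ => π / ‖dir θ‖ :=
    continuous_const.div continuous_norm_dir fun θ => (norm_dir_pos θ).ne'
  have hev2 : ∀ᶠ θ in 𝓝 θ₀, 0 < π / ‖dir θ‖ - cdf.implicitFunction hn if₂ θ :=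
    (hexitc.continuousAt.sub hψc).eventually
      (lt_mem_nhds (show (0 : ℝ) < π / ‖dir θ₀‖ - cdf.implicitFunction hn if₂ θ₀ by rw [hψ0]; linarith [hI.2]))
  -- so by ray-wise uniqueness they are the selected Fermi points
  have heq : u =ᶠ[𝓝 θ₀] cdf.implicitFunction hn if₂ := by
    filter_upwards [hψeq, hev1, hev2] with θ hθ h1 h2
    have hψroot : IsBandFermiRadius (μ - δ (cdf.implicitFunction hn if₂ θ • dir θ)) θ (cdf.implicitFunction hn if₂ θ) := by
      refine ⟨⟨h1.le, ?_⟩, ?_⟩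
      · rw [← le_div_iff₀ (norm_dir_pos θ)]; linarith
      · show rayDispersion (θ, cdf.implicitFunction hn if₂ θ) = μ - δ (cdf.implicitFunction hn if₂ θ • dir θ)
        have : rayDispersion (θ, cdf.implicitFunction hn if₂ θ) + δ (cdf.implicitFunction hn if₂ θ • dir θ) = μ := by
          rw [← hG0]; exact hθ
        linarith
    exact shifted_unique B hδ hlo hhi (radialLipschitz_of_fderiv_le (fun k _ => hdiffδ k) hκ θ) hκ₁ (hu θ) hψroot
  exact hψ.congr_of_eventuallyEq heq

/-- **The perturbed Fermi radius is `Cⁿ` in the angle** (global form of `contDiffAt_of_isRoot`). [cite: BenfattoGiulianiMastropietro2006, §2.4 Lemma 2.1 (2.40)] -/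
theorem contDiff_of_isRoot : ContDiff ℝ n u :=
  contDiff_iff_contDiffAt.2 fun θ => contDiffAt_of_isRoot B hδs hn hδ hlo hhi hκ hκ₁ hu θ

/-- `u` is differentiable. [folklore] -/
theorem differentiable_of_isRoot : Differentiable ℝ u :=
  (contDiff_of_isRoot B hδs hn hδ hlo hhi hκ hκ₁ hu).differentiable hn

/-! ## §3 The angular derivative and BGM (2.40) at first order -/

/-- **The angular derivative of the perturbed Fermi radius**: `u' = -∂_θG/∂_tG` at `(θ, u θ)` (differentiate `G(θ, u θ) = μ`).
[cite: BenfattoGiulianiMastropietro2006, §2.4 Lemma 2.1 (2.40)] -/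
theorem hasDerivAt_of_isRoot (θ : ℝ) :
    HasDerivAt u (-(rayDispersionDθ θ (u θ) + fderiv ℝ δ (u θ • dir θ) (u θ • dir (θ + π / 2))) /
      (rayDispersionDt θ (u θ) + fderiv ℝ δ (u θ • dir θ) (dir θ))) θ := by
  set G : ℝ × ℝ → ℝ := fun p => rayDispersion p + δ (p.2 • dir p.1) with hGdef
  have hdiffδ : ∀ k, DifferentiableAt ℝ δ k := fun k => (hδs.differentiable hn) k
  have hu' : HasDerivAt u (deriv u θ) θ := (differentiable_of_isRoot B hδs hn hδ hlo hhi hκ hκ₁ hu θ).hasDerivAt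
  have hGd : DifferentiableAt ℝ G (θ, u θ) := ((contDiff_pertLevel hδs).differentiable hn) _
  have hF : HasFDerivAt G (fderiv ℝ G (θ, u θ)) (θ, u θ) := hGd.hasFDerivAt
  have hg : HasDerivAt (fun ϑ : ℝ => ((ϑ, u ϑ) : ℝ × ℝ)) ((1 : ℝ), deriv u θ) θ := (hasDerivAt_id θ).prodMk hu'
  have hcomp : HasDerivAt (G ∘ fun ϑ : ℝ => ((ϑ, u ϑ) : ℝ × ℝ)) (fderiv ℝ G (θ, u θ) (1, deriv u θ)) θ :=
    HasFDerivAt.comp_hasDerivAt (l := G) (f := fun ϑ : ℝ => ((ϑ, u ϑ) : ℝ × ℝ)) θ hF hg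
  have hconst : HasDerivAt (G ∘ fun ϑ : ℝ => ((ϑ, u ϑ) : ℝ × ℝ)) 0 θ := by
    have : (G ∘ fun ϑ : ℝ => ((ϑ, u ϑ) : ℝ × ℝ)) = fun _ => μ := by
      funext ϑ
      show rayDispersion (ϑ, u ϑ) + δ (u ϑ • dir ϑ) = μ
      linarith [(hu ϑ).2]
    rw [this]; exact hasDerivAt_const θ μ
  have hrel := hcomp.unique hconst
  rw [fderiv_pertLevel_apply hGd (hdiffδ _), one_mul] at hrel
  have hGt := pertDt_pos B hδ hlo hhi hκ hκ₁ hu θ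
  have hval : deriv u θ = -(rayDispersionDθ θ (u θ) + fderiv ℝ δ (u θ • dir θ) (u θ • dir (θ + π / 2))) /
      (rayDispersionDt θ (u θ) + fderiv ℝ δ (u θ • dir θ) (dir θ)) := by
    rw [eq_div_iff hGt.ne']
    linarith
  rwa [hval] at hu'

/-- The closed form of `deriv u`. [folklore] -/
theorem deriv_of_isRoot (θ : ℝ) :
    deriv u θ = -(rayDispersionDθ θ (u θ) + fderiv ℝ δ (u θ • dir θ) (u θ • dir (θ + π / 2))) /
      (rayDispersionDt θ (u θ) + fderiv ℝ δ (u θ • dir θ) (dir θ)) :=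
  (hasDerivAt_of_isRoot B hδs hn hδ hlo hhi hκ hκ₁ hu θ).deriv

/-- **Speed bound**: `|u'(θ)| ≤ (4 + κ₁) u(θ)/(Dt_min - κ₁)`. [folklore] -/
theorem abs_deriv_le (θ : ℝ) : |deriv u θ| ≤ (4 + κ₁) * u θ / (B.Dtmin - κ₁) := by
  have hsq := abs_apply_le_pi_of_isBandFermiRadius (hu θ)
  have hpos : 0 < u θ := (mem_Ioo_of_shifted B hδ hlo hhi (hu θ)).1
  have hden := Dtmin_sub_le_pertDt B hδ hlo hhi hκ hu θ
  have hden0 : 0 < B.Dtmin - κ₁ := sub_pos.2 hκ₁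
  have hA := abs_fderiv_smul_dir_le (hκ _ hsq) (u θ) (θ + π / 2)
  have hD := abs_rayDispersionDθ_le θ (u θ)
  rw [abs_of_pos hpos] at hA hD
  rw [deriv_of_isRoot B hδs hn hδ hlo hhi hκ hκ₁ hu θ, abs_div, abs_neg,
    abs_of_pos (pertDt_pos B hδ hlo hhi hκ hκ₁ hu θ), div_le_div_iff₀ (hden0.trans_le hden) hden0]
  have hnum : |rayDispersionDθ θ (u θ) + fderiv ℝ δ (u θ • dir θ) (u θ • dir (θ + π / 2))| ≤ (4 + κ₁) * u θ := by
    refine (abs_add_le _ _).trans ?_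
    linarith
  have h0 : 0 ≤ (4 + κ₁) * u θ := le_trans (abs_nonneg _) hnum
  calc |rayDispersionDθ θ (u θ) + fderiv ℝ δ (u θ • dir θ) (u θ • dir (θ + π / 2))| * (B.Dtmin - κ₁)
        ≤ (4 + κ₁) * u θ * (B.Dtmin - κ₁) := mul_le_mul_of_nonneg_right hnum hden0.le
    _ ≤ (4 + κ₁) * u θ * (rayDispersionDt θ (u θ) + fderiv ℝ δ (u θ • dir θ) (dir θ)) :=
        mul_le_mul_of_nonneg_left hden h0

/-- **BGM (2.40) at first order, pointwise in the angle**: at each `θ` the perturbed radius `u θ` EQUALS the free radius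
`u_ν(θ)` of the shifted level `ν = μ - δ(u θ·dir θ) ∈ [μ - κ₀, μ + κ₀]`, and the slopes differ by at most
`κ₁ (u θ + |u_ν'(θ)|)/(Dt_min - κ₁)`:  `|u'(θ) - bandFermiRadiusDeriv ν θ| ≤ κ₁ (u θ + |bandFermiRadiusDeriv ν θ|)/(Dt_min - κ₁)`.
[cite: BenfattoGiulianiMastropietro2006, §2.4 Lemma 2.1 (2.40)] -/
theorem abs_deriv_sub_bandFermiRadiusDeriv_le (θ : ℝ) :
    |deriv u θ - bandFermiRadiusDeriv (μ - δ (u θ • dir θ)) θ| ≤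
      κ₁ * (u θ + |bandFermiRadiusDeriv (μ - δ (u θ • dir θ)) θ|) / (B.Dtmin - κ₁) := by
  have hsq := abs_apply_le_pi_of_isBandFermiRadius (hu θ)
  have hpos : 0 < u θ := (mem_Ioo_of_shifted B hδ hlo hhi (hu θ)).1
  have ht : bandFermiRadius (μ - δ (u θ • dir θ)) θ = u θ := (eq_bandFermiRadius_of_shifted B hδ hlo hhi (hu θ)).symm
  -- names: D = ∂_θF, T = ∂_tF, A = angular δ-term, Q = radial δ-term, all at the common point
  set D := rayDispersionDθ θ (u θ) with hDdef
  set T := rayDispersionDt θ (u θ) with hTdef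
  set A := fderiv ℝ δ (u θ • dir θ) (u θ • dir (θ + π / 2)) with hAdef
  set Q := fderiv ℝ δ (u θ • dir θ) (dir θ) with hQdef
  have hT : B.Dtmin ≤ T := Dtmin_le_rayDispersionDt_of_shifted B hδ hlo hhi (hu θ)
  have hTpos : 0 < T := B.Dtmin_pos.trans_le hT
  have hQ : |Q| ≤ κ₁ := abs_fderiv_dir_le (hκ _ hsq) θ
  have hA : |A| ≤ κ₁ * u θ := by
    have := abs_fderiv_smul_dir_le (hκ _ hsq) (u θ) (θ + π / 2); rwa [abs_of_pos hpos] at this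
  have hκ₁0 : 0 ≤ κ₁ := (abs_nonneg _).trans hQ
  have hTQ : B.Dtmin - κ₁ ≤ T + Q := by linarith [(abs_le.1 hQ).1]
  have hden0 : 0 < B.Dtmin - κ₁ := sub_pos.2 hκ₁
  have hTQpos : 0 < T + Q := hden0.trans_le hTQ
  have hfree : bandFermiRadiusDeriv (μ - δ (u θ • dir θ)) θ = -D / T := by
    rw [bandFermiRadiusDeriv, ht]
  rw [deriv_of_isRoot B hδs hn hδ hlo hhi hκ hκ₁ hu θ, hfree]
  have hident : -(D + A) / (T + Q) - -D / T = (D * Q - A * T) / ((T + Q) * T) := by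
    field_simp
    ring
  rw [hident, abs_div, abs_mul, abs_of_pos hTQpos, abs_of_pos hTpos, abs_div, abs_neg, abs_of_pos hTpos,
    div_le_div_iff₀ (mul_pos hTQpos hTpos) hden0]
  -- |D Q - A T| (Dtmin - κ₁) ≤ κ₁ (u + |D|/T) (T+Q) T
  have hnum : |D * Q - A * T| ≤ |D| * κ₁ + κ₁ * u θ * T := by
    refine (abs_sub _ _).trans ?_
    rw [abs_mul, abs_mul, abs_of_pos hTpos]
    exact add_le_add (mul_le_mul_of_nonneg_left hQ (abs_nonneg _)) (mul_le_mul_of_nonneg_right hA hTpos.le)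
  have hrhs : κ₁ * (u θ + |D| / T) * ((T + Q) * T) = (κ₁ * u θ * T + |D| * κ₁) * (T + Q) := by
    field_simp
  rw [hrhs]
  have h0 : 0 ≤ |D| * κ₁ + κ₁ * u θ * T := by positivity
  calc |D * Q - A * T| * (B.Dtmin - κ₁) ≤ (|D| * κ₁ + κ₁ * u θ * T) * (B.Dtmin - κ₁) :=
        mul_le_mul_of_nonneg_right hnum hden0.le
    _ ≤ (|D| * κ₁ + κ₁ * u θ * T) * (T + Q) := mul_le_mul_of_nonneg_left hTQ h0
    _ = (κ₁ * u θ * T + |D| * κ₁) * (T + Q) := by ring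

end Regularity

end Summit.HubbardSuperconductivity.HubbardSuperconductivity.Theorems.PerturbedFermiCurve

end
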